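/-
Copyright (c) 2026 the pub-hodgecm-mathlib formalisation cell (harness21).  Prover seat hodgecm-mathlib-K2E5-p16 (g3): Track B «K2-LIT»,
#184♮ = hLiu418 = stmt-HodgeConjecture-24832; socket #33s `sig_K2LiuZetaSNonvanishingData` of `Cruxes/HLiu418/Lines/K2_Liu_CurveThetaSigs_U5d_ZetaS.lean`
(ED. 6, typist K2Liu-plan (g3), cand 65fde94a4071edfc :512–:570); LEAD F0P6-plan (g11) rulings «M-155j» ∕ «M-155m» (deal (α): ASSEMBLY MODULO ONE ORGAN); 2026-09-04.
-/
import Summits.HodgeConjecture.HodgeConjecture.Theorems.K2LiuZetaSKFiniteSmear          -- ★ O33.5b (K2Liu-p06 g2): `exists_smear_admissible_zetaS_ne_zero` (+ ★ O33.2∕O33.3∕O33.4a∕O33.5a)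
import Summits.HodgeConjecture.HodgeConjecture.Theorems.K2LiuZetaSDatumFactorisation   -- ★ O33.7a (K2Liu-p06 g2): `exists_factorisation_through_archPart`, `commute_and_invariant_of_archPart_eq_one`, `isCompact_map_archPart`
import Summits.HodgeConjecture.HodgeConjecture.Theorems.K2LiuIwasawaDatumAdaptedStd    -- ★ J2 (this seat): `iwasawaDatumAdapted_std` (the STANDARD `S`-adapted datum)
import HarnessLib

/-!
# Crux `HLiu418`, Track B road `K2_Liu`, unit U5d «`Z_S`», socket #33s «THE DOUBLING ZETA INTEGRAL DOES NOT VANISH IDENTICALLY ON GOOD SECTIONS»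
# — the ASSEMBLY MODULO ONE ORGAN: #33s from the big-cell section #33b

Cell `hodgecm-mathlib`, crux item hLiu418 = `stmt-HodgeConjecture-24832`, route of record `HCCMUnconditional`; squad K2, LEAD F0P6-plan (g11) (rulings
«M-155j» ∕ «M-155m»), dealer K2E3-plan (g3), typist K2Liu-plan (g3), prover K2E5-p16 (g3).  THEOREMS ONLY (no `def`, no instance, no notation, no `sorry`);
lane `--supports stmt-HodgeConjecture-24832 --as helper` (count-neutral helper).

WHAT IS PROVED.  **`zetaSNonvanishingData_of_bigCellSection (hBC) : ‹#33s›`** — the conclusion is socket #33s `sig_K2LiuZetaSNonvanishingData` (U5d ED. 6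
:512–:570) BYTES VERBATIM; the ONE hypothesis `hBC` is the ∀-closed statement «WORDS-33b» (= socket #33b `sig_K2LiuSiegelBigCellSection` of U5d ED. 7, organ
(LS5b)(i) «GOOD SECTIONS SUPPORTED IN THE BIG CELL EXIST»): in the frame of #33s, for every open neighbourhood `U` of `1` in `G_∞ × G_S` there are open
levels `K′_v ≤ H_v` (`v ∈ S`), a CONTINUOUS Siegel section `φ♭ ∈ I(s₀, χ)` right-invariant under `{k : k_∞ = 1, k_v ∈ K_{H,v} (v ∉ S), k_v ∈ K′_v (v ∈ S)}`, and
a real weight `g ≥ 0` with `φ♭(ι(ιA(x), 1)) = g(x)`, `supp g ⊆ U`, `∫ g > 0` (K2Liu-p06 (g2)'s `REPORT-33s-REMAINING` §3 `exists_bigCellSection`: local big-cell open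
embedding at `∞` and `v ∈ S`, unramified vectors off `S`, restricted product of local sections).

PROOF (K2Liu-p06 (g2)'s payer recipe §2, with ruling «M-155j»'s standard datum threaded).  (1) `𝒦` := ★ `iwasawaDatumAdapted_std` — an Iwasawa datum with
`K^S_H ≤ 𝒦.K` AND `𝒦.IsStd` (the two datum conjuncts of the socket).  (2) `𝕂 := ↥(𝒦.K.map archPart)` (compact, ★ `isCompact_map_archPart`) with a Haar measure,
`a := archToAdelic ∘ subtype` (continuous).  (3) `[φ₁] ≠ 0` in `L²` (continuity + positivity of `μ` on opens) ⇒ the good set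
`U := {x | ‖[φ₁]‖²/2 < Re ⟪[φ₁], R(placesEmbed x)[φ₁]⟫}` is an open neighbourhood of `1` (★ O33.4a); `hBC` at `U` gives `K′, φ♭, g`.  (4) The open level
`K_f := {f | f_v ∈ K_{H,v} (v ∉ S), f_v ∈ K′_v (v ∈ S)}` (open through ★ `splitPlaces` and ★ `isOpen_boxSubgroup`) fixes `φ♭` on the right, so ★ O33.7a
`exists_factorisation_through_archPart` gives the finite-type hypothesis `hK` of the smear step over the finite set of translates, and ★
`commute_and_invariant_of_archPart_eq_one` gives `hKinv` for `K^S_H`.  (5) ★ O33.5b `exists_smear_admissible_zetaS_ne_zero` (with ★ `continuous_iotaA` from `_hιA`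
and `_hdecay` by value) returns the admissible `φ` (Siegel section, `𝒦`-finite, continuous, `K^S_H`-invariant) and `g₀` with `Z_S(φ, φ₁, φ₁(g₀ • ·)) ≠ 0`.

HONEST LABEL.  Count-neutral file of the K2_Liu road; #33s stays OPEN until #33b is ★ (then it ties `:= zetaSNonvanishingData_of_bigCellSection ‹#33b payer›`):
`HC_CM` is proved only modulo the 7 printed citations (2 remaining named inputs: hLiu418 = `stmt-HodgeConjecture-24832`, h413 = `stmt-HodgeConjecture-24833`)
until rung 0 closes.

## References
* [Liu2011] Y. Liu, *Arithmetic theta lifting and L-derivatives for unitary groups I*, ANT 5 (2011): §2C (2-5) pp. 863–864.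
* [HarrisKudlaSweet1996] M. Harris, S. Kudla, W. J. Sweet, JAMS 9 (1996): Thm. 4.3 (i) p. 962, §6 (6.27)–(6.28) p. 973.
* [Tan1999] V. Tan, Canad. J. Math. 51 (1999): §1 p. 166 (`K = K_∞ ∏ K_v`, standard sections).
* [BorelJacquet1979] A. Borel, H. Jacquet, PSPM 33.1 (1979): §4.1.
* [BrockerTomDieck1985] T. Bröcker, T. tom Dieck, GTM 98 (1985): III (5.6)–(5.7) (the `K`-finite smear, through ★ O33.5b).
-/

set_option autoImplicit false
set_option linter.dupNamespace false

noncomputable section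

open scoped Matrix RestrictedProduct InnerProductSpace
open Filter Topology Set MeasureTheory NumberField IsDedekindDomain NumberField.mixedEmbedding
open Literature.NumberTheory.Automorphic Literature.NumberTheory.Automorphic.UnitaryGroup Literature.NumberTheory.GaloisRepresentations
open Literature.NumberTheory.GelbartRogawski1991 Literature.NumberTheory.GelbartRogawski1991.GRConstruction
open Literature.NumberTheory.K2Lit.SiegelDoubled Literature.NumberTheory.K2Lit.PlaceSplitting
open Summit.HodgeConjecture.HodgeConjecture.Cruxes.HLiu418.K2LiuZetaSKFiniteSmear
open Summit.HodgeConjecture.HodgeConjecture.Cruxes.HLiu418.K2LiuZetaSDatumFactorisation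
open Summit.HodgeConjecture.HodgeConjecture.Cruxes.HLiu418.K2LiuZetaSWeightIntegrable
open Summit.HodgeConjecture.HodgeConjecture.Cruxes.HLiu418.K2LiuZetaSApproximateIdentity
open Summit.HodgeConjecture.HodgeConjecture.Cruxes.HLiu418.K2LiuZetaSInnerProduct
open Summit.HodgeConjecture.HodgeConjecture.Cruxes.HLiu418.K2LiuIwasawaDatumAdaptedStd

namespace Summit.HodgeConjecture.HodgeConjecture.Cruxes.HLiu418.K2LiuZetaSNonvanishingDataOfBigCell

-- measured 2026-09-04: fails at 400 000 heartbeats (whnf time-out in the `K_f`-invariance ∕ factorisation bookkeeping), passes at 1 000 000; reason: the socket frame is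
-- `HA`-typed while the ★ organs O33.7a ∕ `archToAdelic` ∕ `finAdelicToAdelic` are typed on the datum's `Adelic` — the same defeq-but-not-reducible pair that costs
-- ★ #31p `isCompact_adapted` and ★ `iwasawaDatumAdapted_std` the same budget
set_option maxHeartbeats 1000000 in
/-- **#33s FROM #33b — «THE DOUBLING ZETA INTEGRAL DOES NOT VANISH IDENTICALLY ON GOOD SECTIONS», assembled modulo the big-cell section.**
Hypothesis `hBC` = WORDS-33b (socket #33b `sig_K2LiuSiegelBigCellSection`, ∀-closed over the #33s frame); conclusion = socket #33s
`sig_K2LiuZetaSNonvanishingData` (U5d ED. 6) BYTES VERBATIM.  Proof: K2Liu-p06 (g2)'s recipe over ★ O33.5b ∕ O33.7a with the STANDARD `S`-adapted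
datum of ★ `iwasawaDatumAdapted_std` (module docstring, steps (1)–(5)).
[cite: Liu2011, §2C (2-5) pp. 863–864] [cite: HarrisKudlaSweet1996, Thm. 4.3 (i) p. 962, §6 (6.27)–(6.28) p. 973] [cite: Tan1999, §1 p. 166] [cite: BorelJacquet1979, §4.1] -/
theorem zetaSNonvanishingData_of_bigCellSection
    (hBC :
      ∀ (L : Type) [Field L] [NumberField L] [IsCMField L] {N n : ℕ} (e : Fin N × Fin 1 ≃ Fin n)
        (dV : Fin N → L) (hdV : ∀ i, IsCMField.complexConj L (dV i) = dV i) (_hdV0 : ∀ i, dV i ≠ 0)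
        (dW : Fin 1 → L) (hdW : ∀ i, IsCMField.complexConj L (dW i) = dW i) (_hdW0 : ∀ i, dW i ≠ 0)
        (H : Matrix (Fin N) (Fin N) L)
        (t : L) (_ht : t ≠ 0) (g : GL (Fin N) L)
        (_hg : formCongr ((IsCMField.complexConj L : L ≃ₐ[↥(maximalRealSubfield L)] L) : L →+* L) g (t • H) = Matrix.diagonal dV)
        (ιA : (UnitaryGroup.adelicGroupData (Fp L) L (IsCMField.complexConj L) N H).Adelic →*
          UnitaryGroup.adelic (Fp L) L (IsCMField.complexConj L) N (Matrix.diagonal dV))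
        (_hιA : ∀ k, ((ιA k : ↥(UnitaryGroup.adelic (Fp L) L (IsCMField.complexConj L) N (Matrix.diagonal dV))) :
              GL (Fin N) (AdeleRing (𝓞 L) L)) =
            (toAdeleGL L g)⁻¹ * UnitaryGroup.adelicVal (Fp L) L (IsCMField.complexConj L) N H k * toAdeleGL L g)
        (S : Finset (HeightOneSpectrum (𝓞 (Fp L)))) [DecidableEq (HeightOneSpectrum (𝓞 (Fp L)))]
        [MeasurableSpace (UnitaryGroup.arch (Fp L) L (IsCMField.complexConj L) N H)]
        [BorelSpace (UnitaryGroup.arch (Fp L) L (IsCMField.complexConj L) N H)]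
        [∀ v : HeightOneSpectrum (𝓞 (Fp L)), MeasurableSpace (UnitaryGroup.localPi L (IsCMField.complexConj L) N H v)]
        [∀ v : HeightOneSpectrum (𝓞 (Fp L)), BorelSpace (UnitaryGroup.localPi L (IsCMField.complexConj L) N H v)]
        (νinf : Measure (UnitaryGroup.arch (Fp L) L (IsCMField.complexConj L) N H)) [νinf.IsHaarMeasure]
        (νS : ∀ v : S, Measure (UnitaryGroup.localPi L (IsCMField.complexConj L) N H v.1)) [∀ v, (νS v).IsHaarMeasure]
        (χ : HeckeCharacter L) (_hχ : ∀ v, v ∉ S → ∀ w' : UnitaryGroup.PlacesOver L v, χ.IsUnramifiedAt w'.1)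
        (s₀ : ℂ)
        (U : Set (UnitaryGroup.arch (Fp L) L (IsCMField.complexConj L) N H ×
          (Π v : S, UnitaryGroup.localPi L (IsCMField.complexConj L) N H v.1)))
        (_hU : IsOpen U) (_h1 : (1 : UnitaryGroup.arch (Fp L) L (IsCMField.complexConj L) N H ×
          (Π v : S, UnitaryGroup.localPi L (IsCMField.complexConj L) N H v.1)) ∈ U),
      ∃ (K' : ∀ v : S, Subgroup (UnitaryGroup.localPi L (IsCMField.complexConj L) (n + n) (hermD L e dV hdV dW hdW) v.1))
        (φb : HA L e dV hdV dW hdW → ℂ)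
        (g : UnitaryGroup.arch (Fp L) L (IsCMField.complexConj L) N H ×
          (Π v : S, UnitaryGroup.localPi L (IsCMField.complexConj L) N H v.1) → ℝ),
        (∀ v : S, IsOpen (K' v : Set (UnitaryGroup.localPi L (IsCMField.complexConj L) (n + n) (hermD L e dV hdV dW hdW) v.1))) ∧
        IsSiegelDeltaSection L e dV hdV dW hdW χ s₀ φb ∧ Continuous φb ∧
        (∀ h k : HA L e dV hdV dW hdW,
          UnitaryGroup.archPart (Fp L) L (IsCMField.complexConj L) (n + n) (hermD L e dV hdV dW hdW) k = 1 →
          (∀ v, v ∉ S → UnitaryGroup.evalPlace (Fp L) L (IsCMField.complexConj L) (n + n) (hermD L e dV hdV dW hdW) v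
              (UnitaryGroup.finPart (Fp L) L (IsCMField.complexConj L) (n + n) (hermD L e dV hdV dW hdW) k) ∈
            UnitaryGroup.localInt L (IsCMField.complexConj L) (n + n) (hermD L e dV hdV dW hdW) v) →
          (∀ v : S, UnitaryGroup.evalPlace (Fp L) L (IsCMField.complexConj L) (n + n) (hermD L e dV hdV dW hdW) v.1
              (UnitaryGroup.finPart (Fp L) L (IsCMField.complexConj L) (n + n) (hermD L e dV hdV dW hdW) k) ∈ K' v) →
          φb (h * k) = φb h) ∧
        (∀ x, φb (iotaLeft L e dV hdV dW hdW (ιA (placesEmbed L H S x))) = ((g x : ℝ) : ℂ)) ∧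
        0 ≤ g ∧ Function.support g ⊆ U ∧
        0 < ∫ x, g x ∂(νinf.prod (Measure.pi νS))) :
    ∀ (L : Type) [Field L] [NumberField L] [IsCMField L] {N n : ℕ} (e : Fin N × Fin 1 ≃ Fin n)
      (dV : Fin N → L) (hdV : ∀ i, IsCMField.complexConj L (dV i) = dV i) (_hdV0 : ∀ i, dV i ≠ 0)
      (dW : Fin 1 → L) (hdW : ∀ i, IsCMField.complexConj L (dW i) = dW i) (_hdW0 : ∀ i, dW i ≠ 0)
      (H : Matrix (Fin N) (Fin N) L)
      (t : L) (_ht : t ≠ 0) (g : GL (Fin N) L)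
      (_hg : formCongr ((IsCMField.complexConj L : L ≃ₐ[↥(maximalRealSubfield L)] L) : L →+* L) g (t • H) = Matrix.diagonal dV)
      (ιA : (UnitaryGroup.adelicGroupData (Fp L) L (IsCMField.complexConj L) N H).Adelic →*
        UnitaryGroup.adelic (Fp L) L (IsCMField.complexConj L) N (Matrix.diagonal dV))
      (_hιA : ∀ k, ((ιA k : ↥(UnitaryGroup.adelic (Fp L) L (IsCMField.complexConj L) N (Matrix.diagonal dV))) :
            GL (Fin N) (AdeleRing (𝓞 L) L)) =
          (toAdeleGL L g)⁻¹ * UnitaryGroup.adelicVal (Fp L) L (IsCMField.complexConj L) N H k * toAdeleGL L g)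
      (S : Finset (HeightOneSpectrum (𝓞 (Fp L)))) [DecidableEq (HeightOneSpectrum (𝓞 (Fp L)))]
      [MeasurableSpace (UnitaryGroup.arch (Fp L) L (IsCMField.complexConj L) N H)]
      [BorelSpace (UnitaryGroup.arch (Fp L) L (IsCMField.complexConj L) N H)]
      [∀ v : HeightOneSpectrum (𝓞 (Fp L)), MeasurableSpace (UnitaryGroup.localPi L (IsCMField.complexConj L) N H v)]
      [∀ v : HeightOneSpectrum (𝓞 (Fp L)), BorelSpace (UnitaryGroup.localPi L (IsCMField.complexConj L) N H v)]
      (νinf : Measure (UnitaryGroup.arch (Fp L) L (IsCMField.complexConj L) N H)) [νinf.IsHaarMeasure]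
      (νS : ∀ v : S, Measure (UnitaryGroup.localPi L (IsCMField.complexConj L) N H v.1)) [∀ v, (νS v).IsHaarMeasure]
      (μ : Measure (UnitaryGroup.adelicGroupData (Fp L) L (IsCMField.complexConj L) N H).automorphicQuotient)
      [(UnitaryGroup.adelicGroupData (Fp L) L (IsCMField.complexConj L) N H).IsAutomorphicMeasure μ]
      [CompactSpace (UnitaryGroup.adelicGroupData (Fp L) L (IsCMField.complexConj L) N H).automorphicQuotient]
      (χ : HeckeCharacter L) (_hχu : χ.IsUnitary)
      (_hχ : ∀ v, v ∉ S → ∀ w' : UnitaryGroup.PlacesOver L v, χ.IsUnramifiedAt w'.1)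
      -- local Iwasawa decomposition at every `v ∉ S` (by value, as #31p ∕ #31s)
      (_hIw : ∀ v, v ∉ S → ∀ x : UnitaryGroup.localPi L (IsCMField.complexConj L) (n + n) (hermD L e dV hdV dW hdW) v,
        ∃ p ∈ siegelDeltaLoc L e dV hdV dW hdW v,
          ∃ k ∈ UnitaryGroup.localInt L (IsCMField.complexConj L) (n + n) (hermD L e dV hdV dW hdW) v, x = p * k)
      (s₀ : ℂ) (_hs₀ : (N : ℝ) / 2 - 1 < s₀.re)
      -- a continuous height of type `(P_Δ, modDelta)` with the sharp local decay of #32d (by value)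
      (Φ : HA L e dV hdV dW hdW → ℝ) (_hΦc : Continuous Φ) (_hΦpos : ∀ x, 0 < Φ x)
      (_hΦ : ∀ p x : HA L e dV hdV dW hdW, IsSiegelDelta L e dV hdV dW hdW p →
        Φ (p * x) = modDelta L e dV hdV dW hdW p * Φ x)
      (_hdecay : ∀ τ : ℝ, 2 * (N : ℝ) - 2 < τ →
        Integrable (fun x => Φ (iotaLeft L e dV hdV dW hdW (ιA (placesEmbed L H S x))) ^ τ) (νinf.prod (Measure.pi νS)))
      (φ₁ : (UnitaryGroup.adelicGroupData (Fp L) L (IsCMField.complexConj L) N H).automorphicQuotient → ℂ)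
      (_hφ₁c : Continuous φ₁) (_hφ₁ : φ₁ ≠ 0),
      ∃ (𝒦 : IwasawaDatum L e dV hdV dW hdW) (φ : HA L e dV hdV dW hdW → ℂ),
        𝒦.IsStd ∧
        (∀ k : HA L e dV hdV dW hdW,
          UnitaryGroup.archPart (Fp L) L (IsCMField.complexConj L) (n + n) (hermD L e dV hdV dW hdW) k = 1 →
          (∀ v, UnitaryGroup.evalPlace (Fp L) L (IsCMField.complexConj L) (n + n) (hermD L e dV hdV dW hdW) v
              (UnitaryGroup.finPart (Fp L) L (IsCMField.complexConj L) (n + n) (hermD L e dV hdV dW hdW) k) ∈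
            UnitaryGroup.localInt L (IsCMField.complexConj L) (n + n) (hermD L e dV hdV dW hdW) v) →
          (∀ v ∈ S, UnitaryGroup.evalPlace (Fp L) L (IsCMField.complexConj L) (n + n) (hermD L e dV hdV dW hdW) v
              (UnitaryGroup.finPart (Fp L) L (IsCMField.complexConj L) (n + n) (hermD L e dV hdV dW hdW) k) = 1) →
          k ∈ 𝒦.K) ∧
        IsSiegelDeltaSection L e dV hdV dW hdW χ s₀ φ ∧ IsKFinite 𝒦 φ ∧ Continuous φ ∧
        (∀ h k : HA L e dV hdV dW hdW,
          UnitaryGroup.archPart (Fp L) L (IsCMField.complexConj L) (n + n) (hermD L e dV hdV dW hdW) k = 1 →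
          (∀ v, UnitaryGroup.evalPlace (Fp L) L (IsCMField.complexConj L) (n + n) (hermD L e dV hdV dW hdW) v
              (UnitaryGroup.finPart (Fp L) L (IsCMField.complexConj L) (n + n) (hermD L e dV hdV dW hdW) k) ∈
            UnitaryGroup.localInt L (IsCMField.complexConj L) (n + n) (hermD L e dV hdV dW hdW) v) →
          (∀ v ∈ S, UnitaryGroup.evalPlace (Fp L) L (IsCMField.complexConj L) (n + n) (hermD L e dV hdV dW hdW) v
              (UnitaryGroup.finPart (Fp L) L (IsCMField.complexConj L) (n + n) (hermD L e dV hdV dW hdW) k) = 1) →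
          φ (h * k) = φ h) ∧
        ∃ g₀ : (UnitaryGroup.adelicGroupData (Fp L) L (IsCMField.complexConj L) N H).Adelic,
          zetaS L e dV hdV dW hdW H S νinf νS μ ιA φ φ₁ (fun x => φ₁ (g₀ • x)) ≠ 0 := by
  intro L _ _ _ N n e dV hdV hdV0 dW hdW hdW0 H t ht g hg ιA hιA S _ _ _ _ _ νinf _ νS _ μ _ _ χ hχu hχ hIw s₀ hs₀ Φ hΦc hΦpos hΦ hdecay
    φ₁ hφ₁c hφ₁
  classical
  -- (1) the STANDARD `S`-adapted Iwasawa datum (ruling «M-155j», ★ `iwasawaDatumAdapted_std`)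
  obtain ⟨𝒦, hKS, hstd⟩ := iwasawaDatumAdapted_std L e dV hdV hdV0 dW hdW hdW0 S hIw
  -- (3) `[φ₁] ≠ 0` and the good set
  set F : (UnitaryGroup.adelicGroupData (Fp L) L (IsCMField.complexConj L) N H).L2 μ := (memLp_two_of_continuous _ μ hφ₁c).toLp φ₁ with hFdef
  have hF : F ≠ 0 := by
    intro hF0
    apply hφ₁
    have hae : φ₁ =ᵐ[μ] 0 := by
      have h1 : (F : (UnitaryGroup.adelicGroupData (Fp L) L (IsCMField.complexConj L) N H).automorphicQuotient → ℂ) =ᵐ[μ] φ₁ :=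
        MemLp.coeFn_toLp _
      have h2 : (F : (UnitaryGroup.adelicGroupData (Fp L) L (IsCMField.complexConj L) N H).automorphicQuotient → ℂ) =ᵐ[μ] 0 := by
        rw [hF0]
        exact Lp.coeFn_zero _ _ _
      exact h1.symm.trans h2
    exact (Continuous.ae_eq_iff_eq μ hφ₁c continuous_const).1 hae
  set U : Set (UnitaryGroup.arch (Fp L) L (IsCMField.complexConj L) N H ×
      (Π v : S, UnitaryGroup.localPi L (IsCMField.complexConj L) N H v.1)) :=
    {x | ‖F‖ ^ 2 / 2 < RCLike.re ⟪F, (UnitaryGroup.adelicGroupData (Fp L) L (IsCMField.complexConj L) N H).rightRegular μ (placesEmbed L H S x) F⟫_ℂ}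
    with hUdef
  have hUo : IsOpen U := isOpen_setOf_lt_re_inner_rightRegular _ μ (continuous_placesEmbed L H S) F
  have h1U : (1 : UnitaryGroup.arch (Fp L) L (IsCMField.complexConj L) N H ×
      (Π v : S, UnitaryGroup.localPi L (IsCMField.complexConj L) N H v.1)) ∈ U :=
    mem_setOf_lt_re_inner_rightRegular _ μ (map_one (placesEmbed L H S)) hF
  -- the big-cell section (#33b) at the good set
  obtain ⟨K', φb, gw, hK'o, hφb, hφbc, hφbinv, hgφ, hg0, hgsupp, hgpos⟩ :=
    hBC L e dV hdV hdV0 dW hdW hdW0 H t ht g hg ιA hιA S νinf νS χ hχ s₀ U hUo h1U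
  -- (2) the compact group `𝕂 = archPart(K)` with a Haar measure, and `a : 𝕂 →* H(𝔸)`
  have hKc := 𝒦.isCompact_K
  haveI : CompactSpace ↥(𝒦.K.map (UnitaryGroup.archPart (Fp L) L (IsCMField.complexConj L) (n + n) (hermD L e dV hdV dW hdW))) :=
    isCompact_iff_compactSpace.1 (isCompact_map_archPart (Fp L) L (IsCMField.complexConj L) (n + n) (hermD L e dV hdV dW hdW) hKc)
  letI : MeasurableSpace ↥(𝒦.K.map (UnitaryGroup.archPart (Fp L) L (IsCMField.complexConj L) (n + n) (hermD L e dV hdV dW hdW))) := borel _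
  haveI : BorelSpace ↥(𝒦.K.map (UnitaryGroup.archPart (Fp L) L (IsCMField.complexConj L) (n + n) (hermD L e dV hdV dW hdW))) := ⟨rfl⟩
  let a : ↥(𝒦.K.map (UnitaryGroup.archPart (Fp L) L (IsCMField.complexConj L) (n + n) (hermD L e dV hdV dW hdW))) →* HA L e dV hdV dW hdW := by
    exact (UnitaryGroup.archToAdelic (Fp L) L (IsCMField.complexConj L) (n + n) (hermD L e dV hdV dW hdW)).comp
      (𝒦.K.map (UnitaryGroup.archPart (Fp L) L (IsCMField.complexConj L) (n + n) (hermD L e dV hdV dW hdW))).subtype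
  have ha : Continuous a := by
    exact (UnitaryGroup.continuous_archToAdelic (Fp L) L (IsCMField.complexConj L) (n + n) (hermD L e dV hdV dW hdW)).comp continuous_subtype_val
  -- (4) the open finite level `K_f` fixing `φ♭`
  let Kf : Subgroup (UnitaryGroup.finAdelic (Fp L) L (IsCMField.complexConj L) (n + n) (hermD L e dV hdV dW hdW)) :=
    (⨅ v : {v // v ∉ S}, (UnitaryGroup.localInt L (IsCMField.complexConj L) (n + n) (hermD L e dV hdV dW hdW) v.1).comap
        (UnitaryGroup.evalPlace (Fp L) L (IsCMField.complexConj L) (n + n) (hermD L e dV hdV dW hdW) v.1)) ⊓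
      ⨅ v : S, (K' v).comap (UnitaryGroup.evalPlace (Fp L) L (IsCMField.complexConj L) (n + n) (hermD L e dV hdV dW hdW) v.1)
  have hKf : ∀ f, f ∈ Kf ↔
      (∀ v : {v // v ∉ S}, UnitaryGroup.evalPlace (Fp L) L (IsCMField.complexConj L) (n + n) (hermD L e dV hdV dW hdW) v.1 f ∈
          UnitaryGroup.localInt L (IsCMField.complexConj L) (n + n) (hermD L e dV hdV dW hdW) v.1) ∧
        ∀ v : S, UnitaryGroup.evalPlace (Fp L) L (IsCMField.complexConj L) (n + n) (hermD L e dV hdV dW hdW) v.1 f ∈ K' v := fun f => by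
    simp only [Kf, Subgroup.mem_inf, Subgroup.mem_iInf, Subgroup.mem_comap]
  have hKfo : IsOpen (Kf : Set (UnitaryGroup.finAdelic (Fp L) L (IsCMField.complexConj L) (n + n) (hermD L e dV hdV dW hdW))) := by
    set σS := splitPlaces (Fp L) L (IsCMField.complexConj L) (n + n) (hermD L e dV hdV dW hdW) S with hσS
    have hA : IsOpen (Set.pi Set.univ fun v : S =>
        (K' v : Set (UnitaryGroup.localPi L (IsCMField.complexConj L) (n + n) (hermD L e dV hdV dW hdW) v.1))) :=
      isOpen_set_pi Set.finite_univ fun v _ => hK'o v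
    have hB : IsOpen (boxSubgroup (K := fun v : {v // v ∉ S} => UnitaryGroup.localInt L (IsCMField.complexConj L) (n + n) (hermD L e dV hdV dW hdW) v.1)
        (fun v : {v // v ∉ S} => UnitaryGroup.localInt L (IsCMField.complexConj L) (n + n) (hermD L e dV hdV dW hdW) v.1) :
          Set (Πʳ v : {v // v ∉ S}, [UnitaryGroup.localPi L (IsCMField.complexConj L) (n + n) (hermD L e dV hdV dW hdW) v.1,
            UnitaryGroup.localInt L (IsCMField.complexConj L) (n + n) (hermD L e dV hdV dW hdW) v.1])) :=
      isOpen_boxSubgroup (fun v => isOpen_localInt L (IsCMField.complexConj L) (n + n) (hermD L e dV hdV dW hdW) v.1)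
        (Filter.Eventually.of_forall fun _ => le_rfl)
    have hset : (Kf : Set (UnitaryGroup.finAdelic (Fp L) L (IsCMField.complexConj L) (n + n) (hermD L e dV hdV dW hdW))) =
        σS ⁻¹' ((Set.pi Set.univ fun v : S =>
            (K' v : Set (UnitaryGroup.localPi L (IsCMField.complexConj L) (n + n) (hermD L e dV hdV dW hdW) v.1))) ×ˢ
          (boxSubgroup (K := fun v : {v // v ∉ S} => UnitaryGroup.localInt L (IsCMField.complexConj L) (n + n) (hermD L e dV hdV dW hdW) v.1)
            (fun v : {v // v ∉ S} => UnitaryGroup.localInt L (IsCMField.complexConj L) (n + n) (hermD L e dV hdV dW hdW) v.1) :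
            Set (Πʳ v : {v // v ∉ S}, [UnitaryGroup.localPi L (IsCMField.complexConj L) (n + n) (hermD L e dV hdV dW hdW) v.1,
              UnitaryGroup.localInt L (IsCMField.complexConj L) (n + n) (hermD L e dV hdV dW hdW) v.1]))) := by
      ext f
      simp only [SetLike.mem_coe, hKf, Set.mem_preimage, Set.mem_prod, Set.mem_pi, Set.mem_univ, true_implies, mem_boxSubgroup_iff, hσS,
        splitPlaces_fst_apply, splitPlaces_snd_apply]
      exact and_comm
    rw [hset]
    exact (hA.prod hB).preimage σS.continuous
  -- `φ♭` is right-`K_f`-invariant (the HA-typed clause of #33b, read on the datum's `Adelic`)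
  have hφbKf : ∀ f ∈ Kf, ∀ h : (UnitaryGroup.adelicGroupData (Fp L) L (IsCMField.complexConj L) (n + n) (hermD L e dV hdV dW hdW)).Adelic,
      φb (h * UnitaryGroup.finAdelicToAdelic (Fp L) L (IsCMField.complexConj L) (n + n) (hermD L e dV hdV dW hdW) f) = φb h := by
    intro f hf h
    refine hφbinv h (UnitaryGroup.finAdelicToAdelic (Fp L) L (IsCMField.complexConj L) (n + n) (hermD L e dV hdV dW hdW) f)
      (UnitaryGroup.archPart_finAdelicToAdelic (Fp L) L (IsCMField.complexConj L) (n + n) (hermD L e dV hdV dW hdW) f) (fun v hv => ?_) (fun v => ?_)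
    · rw [UnitaryGroup.finPart_finAdelicToAdelic]
      exact ((hKf f).1 hf).1 ⟨v, hv⟩
    · rw [UnitaryGroup.finPart_finAdelicToAdelic]
      exact ((hKf f).1 hf).2 v
  -- finite type of `φ♭` along `K` (★ O33.7a) and the `K^S_H` invariance
  obtain ⟨R, hR⟩ := exists_factorisation_through_archPart (Fp L) L (IsCMField.complexConj L) (n + n) (hermD L e dV hdV dW hdW) hKc Kf hKfo φb hφbKf
  have hφbc' : Continuous fun h : (UnitaryGroup.adelicGroupData (Fp L) L (IsCMField.complexConj L) (n + n) (hermD L e dV hdV dW hdW)).Adelic => φb h :=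
    hφbc
  let φfam : ↥R → (UnitaryGroup.adelicGroupData (Fp L) L (IsCMField.complexConj L) (n + n) (hermD L e dV hdV dW hdW)).Adelic → ℂ := fun r h =>
    φb (h * UnitaryGroup.finAdelicToAdelic (Fp L) L (IsCMField.complexConj L) (n + n) (hermD L e dV hdV dW hdW)
      (r : UnitaryGroup.finAdelic (Fp L) L (IsCMField.complexConj L) (n + n) (hermD L e dV hdV dW hdW)))
  have hφfam : ∀ r, Continuous (φfam r) := fun r => hφbc'.comp (continuous_id.mul continuous_const)
  let Kinv : Set (HA L e dV hdV dW hdW) := {k |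
    UnitaryGroup.archPart (Fp L) L (IsCMField.complexConj L) (n + n) (hermD L e dV hdV dW hdW) k = 1 ∧
    (∀ v, UnitaryGroup.evalPlace (Fp L) L (IsCMField.complexConj L) (n + n) (hermD L e dV hdV dW hdW) v
        (UnitaryGroup.finPart (Fp L) L (IsCMField.complexConj L) (n + n) (hermD L e dV hdV dW hdW) k) ∈
      UnitaryGroup.localInt L (IsCMField.complexConj L) (n + n) (hermD L e dV hdV dW hdW) v) ∧
    ∀ v ∈ S, UnitaryGroup.evalPlace (Fp L) L (IsCMField.complexConj L) (n + n) (hermD L e dV hdV dW hdW) v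
        (UnitaryGroup.finPart (Fp L) L (IsCMField.complexConj L) (n + n) (hermD L e dV hdV dW hdW) k) = 1}
  have hKinv : ∀ u ∈ Kinv, (∀ k, u * a k = a k * u) ∧ ∀ h, φb (h * u) = φb h := by
    rintro u ⟨hu1, hu2, hu3⟩
    have hkf : UnitaryGroup.finPart (Fp L) L (IsCMField.complexConj L) (n + n) (hermD L e dV hdV dW hdW) u ∈ Kf :=
      (hKf _).2 ⟨fun v => hu2 v.1, fun v => by rw [hu3 v.1 v.2]; exact (K' v).one_mem⟩
    obtain ⟨hc, hi⟩ := commute_and_invariant_of_archPart_eq_one (Fp L) L (IsCMField.complexConj L) (n + n) (hermD L e dV hdV dW hdW) Kf φb hφbKf hu1 hkf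
    exact ⟨fun k => hc _, hi⟩
  -- (5) the smear step (★ O33.5b)
  have hιAc : Continuous ιA := continuous_iotaA L dV H t ht g hg ιA hιA
  obtain ⟨φ, hφsec, hφK, hφc, hφinv, g₀, hne⟩ :=
    exists_smear_admissible_zetaS_ne_zero L e dV hdV dW hdW H S ιA νinf νS μ (Measure.haar) a ha 𝒦 hχu hs₀ hΦc hΦpos hΦ hιAc hdecay hφb hφbc
      φfam hφfam (fun t ht' => hR t ht') Kinv hKinv hg0 hgφ hφ₁c hgsupp hgpos
  exact ⟨𝒦, φ, hstd, hKS, hφsec, hφK, hφc, fun h k hk1 hk2 hk3 => hφinv k ⟨hk1, hk2, hk3⟩ h, g₀, hne⟩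

end Summit.HodgeConjecture.HodgeConjecture.Cruxes.HLiu418.K2LiuZetaSNonvanishingDataOfBigCell

end
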